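/-
Copyright: lit-balaban Phase-2 proof seat p34 (gen 18).  Statement-level skeleton of a published paper; no proof claims beyond what the
kernel checks below.
-/
import Literature.MathematicalPhysics.QuantumFieldTheory.BalabanImbrieJaffe1984to88.BIJ88NeumannPropagatorSmallFieldSupDecay
import Literature.MathematicalPhysics.QuantumFieldTheory.BalabanImbrieJaffe1984to88.BIJ88FreeNeumannResolventRegionTiltedRow
import Literature.MathematicalPhysics.QuantumFieldTheory.BalabanImbrieJaffe1984to88.BIJ88BlockCentredWeight

/-!
# [BalabanImbrieJaffe1985] §7.3 p. 326 / [BalabanImbrieJaffe1988] (2.30) p. 263 — **THE `k`-UNIFORM SUP-NORM (operator-form) DECAY OF THE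
# REGION NEUMANN PROPAGATORS `G_k(Ω,u)` ON A GENERAL `k`-BLOCK UNION `Ω` AT SMALL NON-FLAT FIELDS — the VALUE member of
# [Balaban1983RegularityDecay] (1.10), `|(G_k(Ω,u)f)(x)| ≤ c₀(L^kε)²e^{−t₀ dist_∞(x, supp f)/L^k}‖f‖_∞` with `t₀, c₀` depending on
# `(D, L, a)` only**, for p31's `G_k(Ω,u) = gBox (α_kL^{kD}) ε⁻¹ u k Ω` on EVERY union `Ω` of `k`-blocks of the fine torus, `D = d + 1 ≤ 3`:
# p27's cube theorem `decay110_smallField_cube` with the cube (a chart image of [6]'s box) replaced by an arbitrary block union — Kato's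
# inequality on the region, comparison with the free Neumann region resolvent ON THE TORUS (no chart), Cauchy–Schwarz against its tilted row
# (p34's `BIJ88FreeNeumannResolventRegionTiltedRow` with the block-centred weight of `BIJ88BlockCentredWeight`), and p34's weighted `ℓ²` bound

T. Bałaban, J. Imbrie, A. Jaffe, *Effective action and cluster properties of the abelian Higgs model*, Commun. Math. Phys. **114** (1988)
257–315 [BalabanImbrieJaffe1988], Sect. 2 p. 263 [PDF 7], (2.27)/(2.30); [I] = T. Bałaban, J. Imbrie, A. Jaffe, *Renormalization of the Higgs
model: minimizers, propagators and the stability of mean field theory*, Commun. Math. Phys. **97** (1985) 299–329 [BalabanImbrieJaffe1985],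
§7.3 p. 326 [PDF 28], (6.3.2) p. 320; [6] = T. Bałaban, *Regularity and decay of lattice Green's functions*, Commun. Math. Phys. **89** (1983)
571–597 [Balaban1983RegularityDecay], (1.10) p. 573, (2.44) p. 584.

statement-level skeleton of published theorems with citation tags; proofs where landed; nothing here is a claim about the Yang–Mills mass gap

PDF held: `paper:balaban1988-cmp114-bij-abelian-higgs-effective-action` (journal page = PDF page + 256), p. 262–264 [PDF 6–8];
`paper:balaban1985-cmp97-bij-higgs-minimizers` (journal page = PDF page + 298), p. 326 [PDF 28].

CITATION HEADER (lean-in-tree rule).  Part of the lit-balaban TYPED SKELETON (HOME `run/shared/lean/pub/lit-balaban/`), PHASE-2 proof seat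
p34 gen 18 (unit `lit-balaban-p34-g18`; TAKING line HOME/STATUS.md 2026-08-23T04:22:50Z; free-target protocol G.5-34(d) — source: the
owner's `HOME/lit-balaban-r18/C2S14-CLOSURE.md` v1.16s «REMAINING NON-FLAT FRONT (α′) operator-form (H1.10) for general regions at small u
(kernel form: p34 v1.2 done)»).  WHAT IS REPRODUCED: a located MEMBER of rows **C2.Eq2.30** (owner r18; «random walk expansion of [6]
shows (2.30)») and **C1.Eq7.3.1-7.3.2** (owner r15; [I] p. 326 *"The propagators arising from Δ_k(u_k), under the restriction (7.3.1) on the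
gauge field, also satisfy the regularity and decay estimates of [7]"*): the VALUE member of [6] (1.10) in `k`-UNIFORM OPERATOR form for
p31's region propagators `gBox` on a GENERAL `k`-block union at non-flat small `u` — the hypothesis (H1.10) that p31's
`BIJ88DeltaLocClose235General` displays per region.  No row is restated and no head changes.
USED BY NAME: p27's `kato_region`, `norm_gram_qMatK_region_mulVec_le`, `tilted_sq_QQ_le`, `weight_block_osc`, `towerQQ_mulVec_apply`,
`sum_exp_neg_supDist_scale_le`; p34's `agmon_weighted_region`, `agmon_gap_region`, `weight_bond_osc_sq`, `weight_block_osc_sq`,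
`nOp_mulVec_gBox_mulVec`, `gBox_mulVec_eq_zero_of_not_mem` (gen 16), `lapN`, `massOp_mulVec_apply`, `lapN_mulVec_apply`,
`massOp_mulVec_apply_of_not_mem`, `le_inv_massOp_mulVec`, `inv_massOp_transpose`, `inv_massOp_apply_nonneg` (gen 18, file 1),
`tilted_col_sq_le` (file 3b), `psi`, `psi_shift_sub_abs_le`, `psi_shift_eq_of_not_mem_starB`, `psi_unshift_eq_of_not_mem_starB`,
`psi_drift_le`, `psi_ge`, `psi_self_le` (file 3a); p31's `gBox`/`nOp`/`dN`/`qMatK`/`proj`, `gBox_gaugeAct`, `IsBlockUnion`; r18's `starB`.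
Kind: theorems only (no definition, no `Prop`-valued fact).

THE PROOF (DIVERGENCE OF METHOD from the printed «random walk expansion of [6]», disclosed; same architecture as p27's cube file, §4 there).
(1) `φ = G_k(Ω,u)f` solves `(χD_u)ᴴ(χD_u)φ = 1_Ωf − a′(Q_k|_Ω)ᴴ(Q_k|_Ω)φ` (p34 `nOp_mulVec_gBox_mulVec`) and vanishes off `Ω`.  (2) Kato
(p27 `kato_region`): at the sites of `Ω`, `ε⁻²Σ_μ(Neumann differences of |φ|) + m₀|φ| ≤ g := |f| + α₀(Q^*Q|φ|) + m₀|φ|`,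
`m₀ = (L^kε)⁻²`.
(3) NEW STEP (replacing the box chart): with p34's torus region operator `M = L^{2k}(−Δ^N_Ω) + 1` (`lapN`), `(M|φ|)(y) ≤ (L^kε)²g(y)` at
EVERY site of the torus (`lapN_mulVec_apply` is letter-for-letter Kato's sum; off `Ω` both `|φ|` and the row of `−Δ^N_Ω` vanish), so the
comparison principle `le_inv_massOp_mulVec` gives `|φ(x)| ≤ (L^kε)²Σ_yR_Ω(x,y)g(y)`, `R_Ω = M⁻¹ ≥ 0`.  (4) Cauchy–Schwarz with the weight
`e^{t|x−y|_∞/L^k}`: the tilted row `Σ_y(e^{t|x−y|_∞/L^k}R_Ω(x,y))² ≤ C₀/L^{kD}` is **`region_row_sq_le`** below — file 3b's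
`tilted_col_sq_le` for the block-centred weight `ψ = psi k (2t) x` of file 3a (its three hypotheses are `psi_shift_sub_abs_le`,
`psi_shift_eq_of_not_mem_starB`/`psi_unshift_eq_of_not_mem_starB`, `psi_drift_le`), converted by `psi_ge`/`psi_self_le`
(`e^{t|x−y|_∞/L^k} ≤ e^{ψ(y)−ψ(x)}e^{t(5+D)}`) and the symmetry of `R_Ω`.  (5)–(6) verbatim p27: the source piece
(`sum_exp_neg_supDist_scale_le`), the block piece (`tilted_sq_QQ_le`), the Agmon piece (p34 `agmon_weighted_region` + `agmon_gap_region`),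
and the scalar assembly.

WHAT IS PROVED (0 `sorry`; standard axioms; theorems only).
* §1 **`region_row_sq_le (d ℓ) : ∃ t₁ C₀ > 0, ∀ P, P.d = d+1 → P.L = ℓ+1 → ∀ k, 1 ≤ k ≤ m+K → ∀ Ω, IsBlockUnion k Ω →
  ∀ t ∈ [0,t₁], ∀ x ∈ Ω, Σ_y (e^{t|x−y|_∞/L^k}R_Ω(x,y))² ≤ C₀/L^{kD}`** — p27's `tilted_row_boxR_sq_le` for general block unions.
* §2 **`decay110_smallField_region`** — p27's `decay110_smallField_cube` with `cubeT … c M` + fit hypotheses replaced by `Ω` +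
  `IsBlockUnion k Ω`: `‖(G_k(Ω,u)f)(x)‖ ≤ c₀(L^kε)²e^{−t₀D₀/L^k}F` for every `x`, every `f` with `|f| ≤ F` vanishing at `ℓ^∞`-distance
  `< D₀` from `x`, under p34's bondwise small-field hypotheses inside `Ω`.
* §3 **`decay110_smallField_region_input`** (p31's (H1.10″) binder shape: `B5Ineq137Torus.T`, bound `(L^kε)²·(c₀e^{−δ₀(L^k)⁻¹D}F)`) and
  **`decay110_smallField_region_gaugeAct`** (the bound for `G_k(Ω,u^h)`, every gauge transformation `h`).
* §4 (v1.1) **`decay110_smallPlaquette_region_uniform`** — the bound for EVERY `k`-block union under the (7.3.1)-TYPE smallness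
  `|u(∂p) − 1| ≤ θ` of the fine plaquettes with a threshold depending on `(d, L^k)` only (`T ≥ d(L^k−1)θ`,
  `2(L^k−1)L^k(d+1)T² + 2((d+1)(L^k−1)T)² ≤ 1/2`), via p34 gen 17's blockwise centred gauge `smallField_blockGauge` — the region
  analogue of p27's `decay110_smallPlaquette_cube_uniform`.

HONEST SCOPE.  (i) The VALUE member of (1.10)/(2.30) only, in operator form; the covariant-derivative member and the Hölder member (1.11)
are not treated here.  (ii) GENERAL `k`-block unions `Ω` (`IsBlockUnion k Ω`), every `x` (for `x ∉ Ω` the propagator vanishes); `D = d + 1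
≤ 3`; `1 ≤ k ≤ m + K`.  (iii) Small fields in p34's BONDWISE sense inside `Ω` (`T, δ` with `2(L^k−1)L^kDT² + 2δ² ≤ 1/2`) for the field
itself (§2) or any gauge-equivalent field (§3), and in §4 under the smallness `|u(∂p) − 1| ≤ θ` of the FINE-torus plaquettes of `u` with
a threshold `θ ≲ 1/((d+1)²L^{2k})`; THE PRINTED (7.3.1) is a smallness of the UNIT-lattice plaquette variables and is NOT this hypothesis —
the passage for the backgrounds of record is p33's `BIJ85Claim73PropagatorDecay` lane (as disclosed in p27's file, HONEST SCOPE (iv)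
there).  (iv) Constants existential, explicit in the proof, depending on `(d, ℓ, a)` only — uniform in `k`, in `Ω`, in the volume and
in the field.  (v) `set_option maxHeartbeats 800000` on §2's theorem (long bookkeeping, as in p27's file).  Nothing here is summit progress.
Unit `lit-balaban-p34` (literature-prover-lit-balaban-p34-g18-0), HOME `run/shared/lean/pub/lit-balaban/`, 2026-08-23.  v1.1 (same seat):
+§4 `decay110_smallPlaquette_region_uniform` ((7.3.1)-type fine-plaquette smallness, every block union); §1–§3 byte-identical to v1.0
(p354902) except HONEST SCOPE (iii)'s wording.
-/

open scoped BigOperators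
open Finset Matrix

namespace Literature.MathematicalPhysics.QuantumFieldTheory.BalabanImbrieJaffe1984to88.BIJ88NeumannPropagatorSmallFieldRegionSup

open scoped ComplexConjugate
open Literature.MathematicalPhysics.QuantumFieldTheory.Balaban1983to89
open LatticeFieldCalculus (supDist)
open BIJ88Sect3Statements (U1 toC cfg starB mem_starB norm_toC)
open BIJ85BlockAveragesTorus BIJ85BlockAveragesTorusK
open BIJ88NeumannNoZeroModesTorus (IsBlockUnion)
open BIJ88NeumannPropagator227Torus (nOp gBox dN qMatK proj nOp_eq qMatK_apply qMatK_mulVec proj_mulVec)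
open BIJ88NeumannPropagatorSmallFieldRegion (agmon_weighted_region agmon_gap_region weight_bond_osc_sq weight_block_osc_sq
  nOp_mulVec_gBox_mulVec gBox_mulVec_eq_zero_of_not_mem)
open BIJ88NeumannPropagatorSmallFieldSupDecay (kato_region norm_gram_qMatK_region_mulVec_le)
open BIJ85FreeResolventTorus (towerQQ_mulVec_apply tilted_sq_QQ_le weight_block_osc)
open BIJ85FreeResolventTiltedRow (sum_exp_neg_supDist_scale_le)
open BIJ88FreeNeumannLaplacianRegion (lapN massOp_mulVec_apply lapN_mulVec_apply massOp_mulVec_apply_of_not_mem le_inv_massOp_mulVec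
  inv_massOp_transpose inv_massOp_apply_nonneg)
open BIJ88FreeNeumannResolventRegionTiltedRow (tilted_col_sq_le)
open BIJ88BlockCentredWeight (psi psi_shift_sub_abs_le psi_shift_eq_of_not_mem_starB psi_unshift_eq_of_not_mem_starB psi_drift_le psi_ge
  psi_self_le)

noncomputable section

variable {P : Params}

/-! ## §1 The tilted row of the free region resolvent with the `ℓ^∞`-distance weight, on every `k`-block union -/

/-- **THE TILTED ROW OF `R_Ω = (L^{2k}(−Δ^N_Ω) + 1)⁻¹` WITH THE WEIGHT `e^{t|x−y|_∞/L^k}`, `k`-UNIFORMLY ON EVERY `k`-BLOCK UNION**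
(`D = d + 1 ≤ 3`): there are `t₁, C₀ > 0` depending on `(d, ℓ)` only with `Σ_y (e^{t|x−y|_∞/L^k}R_Ω(x,y))² ≤ C₀/L^{kD}` for every
`1 ≤ k ≤ m + K`, every `k`-block union `Ω`, every `0 ≤ t ≤ t₁` and every `x ∈ Ω` — file 3b's `tilted_col_sq_le` for the block-centred weight
`ψ = psi k (2t) x` of file 3a, `e^{t|x−y|_∞/L^k} ≤ e^{ψ(y)−ψ(x)}·e^{t(5+D)}` (`psi_ge`, `psi_self_le`), and `R_Ω(x,y) = R_Ω(y,x)`.  The free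
input of [6] (1.10) in the squared-row form of p27's `tilted_row_boxR_sq_le`, cube → general block union.
[cite: Balaban1983RegularityDecay, (1.10) p.573] -/
theorem region_row_sq_le (d ℓ : ℕ) (hd3 : d + 1 ≤ 3) (hℓ : 1 ≤ ℓ) :
    ∃ t₁ C₀ : ℝ, 0 < t₁ ∧ 0 < C₀ ∧ ∀ (P : Params), P.d = d + 1 → P.L = ℓ + 1 →
      ∀ k : ℕ, 1 ≤ k → k ≤ P.m + P.K → ∀ Ω : Finset (Balaban1983to89.Site P 0), IsBlockUnion k Ω →
      ∀ t : ℝ, 0 ≤ t → t ≤ t₁ → ∀ x ∈ Ω,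
        ∑ y, (Real.exp (t * (supDist x y : ℝ) / (P.L : ℝ) ^ k) * ((((P.L : ℝ) ^ k) ^ 2) • lapN Ω + 1)⁻¹ x y) ^ 2 ≤
          C₀ / ((P.L : ℝ) ^ k) ^ (d + 1) := by
  obtain ⟨t₀, K, ht₀, hK, h⟩ := tilted_col_sq_le d ℓ hd3 hℓ
  refine ⟨min (t₀ / 2) (1 / 2), Real.exp (t₀ * (5 + ((d + 1 : ℕ) : ℝ))) * K, lt_min (by linarith) (by norm_num), by positivity, ?_⟩
  intro P hPd hPL k hk1 hk Ω hΩ t ht0 ht1 x hx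
  have hD' : (P.d : ℝ) = ((d + 1 : ℕ) : ℝ) := by rw [hPd]
  have hLpos : (0 : ℝ) < P.L := P.cast_L_pos
  have hn : 0 < (P.L : ℝ) ^ k := pow_pos hLpos k
  have hn2 : (0 : ℝ) ≤ ((P.L : ℝ) ^ k) ^ 2 := sq_nonneg _
  set s : ℝ := 2 * t with hs
  have hs0 : 0 ≤ s := by rw [hs]; linarith
  have hst₀ : s ≤ t₀ := by rw [hs]; linarith [ht1.trans (min_le_left _ _)]
  have hs1 : s ≤ 1 := by rw [hs]; linarith [ht1.trans (min_le_right _ _)]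
  -- the three hypotheses of file 3b for the block-centred weight `ψ = psi k s x`
  have hψ : ∀ b ∈ starB Ω, |psi k s x b.tgt - psi k s x b.src| ≤ s / (P.L : ℝ) ^ k :=
    fun b _ => psi_shift_sub_abs_le k hs0 x b.src b.dir
  have hflat : ∀ y ∈ Ω, ∀ μ : Fin P.d, ((⟨y, μ⟩ : PBond P 0) ∉ starB Ω → psi k s x (y.shift μ) = psi k s x y) ∧
      ((⟨y.unshift μ, μ⟩ : PBond P 0) ∉ starB Ω → psi k s x (y.unshift μ) = psi k s x y) :=
    fun y hy μ => ⟨fun hb => psi_shift_eq_of_not_mem_starB hk1 hk hΩ s x hy hb,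
      fun hb => psi_unshift_eq_of_not_mem_starB hk1 hk hΩ s x hy hb⟩
  have hκ : ∀ y ∈ Ω, ∑ μ : Fin P.d, (Real.exp (psi k s x (y.shift μ) - psi k s x y) +
      Real.exp (psi k s x (y.unshift μ) - psi k s x y) - 2) ≤ P.d * ((8 * s + 2 * s ^ 2) / ((P.L : ℝ) ^ k) ^ 2) :=
    fun y _ => psi_drift_le hk1 hs0 hs1 x y
  have hcol := h P hPd hPL k hk Ω hΩ s hs0 hst₀ (psi k s x) x hx hψ hflat hκ
  -- the pointwise comparison of the weights and the symmetry of `R_Ω`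
  have hpt : ∀ y, (Real.exp (t * (supDist x y : ℝ) / (P.L : ℝ) ^ k) * ((((P.L : ℝ) ^ k) ^ 2) • lapN Ω + 1)⁻¹ x y) ^ 2 ≤
      Real.exp (t₀ * (5 + ((d + 1 : ℕ) : ℝ))) *
        (Real.exp (psi k s x y - psi k s x x) * ((((P.L : ℝ) ^ k) ^ 2) • lapN Ω + 1)⁻¹ y x) ^ 2 := by
    intro y
    have hsym : ((((P.L : ℝ) ^ k) ^ 2) • lapN Ω + 1)⁻¹ x y = ((((P.L : ℝ) ^ k) ^ 2) • lapN Ω + 1)⁻¹ y x := by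
      have e := congr_fun (congr_fun (inv_massOp_transpose (((P.L : ℝ) ^ k) ^ 2) Ω) y) x
      rw [Matrix.transpose_apply] at e
      exact e
    have hR0 : 0 ≤ ((((P.L : ℝ) ^ k) ^ 2) • lapN Ω + 1)⁻¹ y x := inv_massOp_apply_nonneg hn2 Ω y x
    have hge := psi_ge hk1 hk hs0 x y
    have hle := psi_self_le hk hs0 x
    rw [hD'] at hle
    -- `t|x−y|/L^k ≤ (ψ(y) − ψ(x)) + s(5 + D)/2`
    have hexp : t * (supDist x y : ℝ) / (P.L : ℝ) ^ k ≤ (psi k s x y - psi k s x x) + s * (5 + ((d + 1 : ℕ) : ℝ)) / 2 := by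
      have e : t * (supDist x y : ℝ) / (P.L : ℝ) ^ k = s * ((supDist x y : ℝ) / (2 * (P.L : ℝ) ^ k) - 5 / 2) + 5 * s / 2 := by
        rw [hs]; field_simp; ring
      rw [e]
      linarith
    have hw : Real.exp (t * (supDist x y : ℝ) / (P.L : ℝ) ^ k) ≤
        Real.exp (psi k s x y - psi k s x x) * Real.exp (s * (5 + ((d + 1 : ℕ) : ℝ)) / 2) := by
      rw [← Real.exp_add]; exact Real.exp_le_exp.2 hexp
    have hfac : Real.exp (s * (5 + ((d + 1 : ℕ) : ℝ)) / 2) ^ 2 ≤ Real.exp (t₀ * (5 + ((d + 1 : ℕ) : ℝ))) := by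
      rw [← Real.exp_nat_mul, Real.exp_le_exp]; push_cast
      nlinarith [show (0 : ℝ) ≤ 5 + ((d + 1 : ℕ) : ℝ) by positivity]
    rw [hsym]
    calc (Real.exp (t * (supDist x y : ℝ) / (P.L : ℝ) ^ k) * ((((P.L : ℝ) ^ k) ^ 2) • lapN Ω + 1)⁻¹ y x) ^ 2
        ≤ (Real.exp (psi k s x y - psi k s x x) * Real.exp (s * (5 + ((d + 1 : ℕ) : ℝ)) / 2) *
            ((((P.L : ℝ) ^ k) ^ 2) • lapN Ω + 1)⁻¹ y x) ^ 2 :=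
          pow_le_pow_left₀ (mul_nonneg (Real.exp_pos _).le hR0) (mul_le_mul_of_nonneg_right hw hR0) 2
      _ = Real.exp (s * (5 + ((d + 1 : ℕ) : ℝ)) / 2) ^ 2 *
            (Real.exp (psi k s x y - psi k s x x) * ((((P.L : ℝ) ^ k) ^ 2) • lapN Ω + 1)⁻¹ y x) ^ 2 := by ring
      _ ≤ _ := mul_le_mul_of_nonneg_right hfac (sq_nonneg _)
  calc ∑ y, (Real.exp (t * (supDist x y : ℝ) / (P.L : ℝ) ^ k) * ((((P.L : ℝ) ^ k) ^ 2) • lapN Ω + 1)⁻¹ x y) ^ 2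
      ≤ ∑ y, Real.exp (t₀ * (5 + ((d + 1 : ℕ) : ℝ))) *
          (Real.exp (psi k s x y - psi k s x x) * ((((P.L : ℝ) ^ k) ^ 2) • lapN Ω + 1)⁻¹ y x) ^ 2 := sum_le_sum fun y _ => hpt y
    _ = Real.exp (t₀ * (5 + ((d + 1 : ℕ) : ℝ))) *
          ∑ y, (Real.exp (psi k s x y - psi k s x x) * ((((P.L : ℝ) ^ k) ^ 2) • lapN Ω + 1)⁻¹ y x) ^ 2 := by rw [mul_sum]
    _ ≤ Real.exp (t₀ * (5 + ((d + 1 : ℕ) : ℝ))) * (K / ((P.L : ℝ) ^ k) ^ (d + 1)) :=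
        mul_le_mul_of_nonneg_left hcol (Real.exp_pos _).le
    _ = _ := by ring

/-! ## §2 The assembly: Kato + comparison with `R_Ω` on the torus + Cauchy–Schwarz + p34's weighted `ℓ²` bound -/

section Assembly

/-- kernel: the scalar bookkeeping of the assembly (verbatim p27's `assembly_arith_cube`): from `v² ≤ C₀(sp⁴/N)·G₂`,
`G₂ ≤ 3(B + α²A_Q + m²A)`, `A_Q ≤ e^{2t}A`, `A ≤ (2sp²/μ₀)²B`, `B ≤ F²E²K·N`, with `α·sp² = a_k ≤ a`, `m·sp² = 1`:
`v ≤ √(C₀·3(1 + 4(a²e² + 1)/μ₀²)·K)·sp²·E·F`. [folklore] -/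
private theorem assembly_arith {vx W G₂ A A_Q B C₀ sp N F E K α m aS a μ₀ e₂ eₜ : ℝ}
    (hv2 : vx ^ 2 ≤ W * G₂) (hW : W ≤ C₀ * (sp ^ 4 / N)) (hN : 0 < N) (hC₀ : 0 ≤ C₀)
    (hG₂ : G₂ ≤ 3 * (B + α ^ 2 * A_Q + m ^ 2 * A)) (hG₂nn : 0 ≤ G₂) (hAQ : A_Q ≤ eₜ * A) (heₜ0 : 0 ≤ eₜ) (heₜ : eₜ ≤ e₂)
    (hA : A ≤ (2 * sp ^ 2 / μ₀) ^ 2 * B) (hB0 : 0 ≤ B) (hμ₀ : 0 < μ₀) (hαsp : α * sp ^ 2 = aS) (haS0 : 0 ≤ aS) (haS : aS ≤ a)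
    (hmsp : m * sp ^ 2 = 1) (hB : B ≤ F ^ 2 * E ^ 2 * (K * N)) (hE : 0 ≤ E) (hK : 0 ≤ K) (hF : 0 ≤ F) :
    vx ≤ Real.sqrt (C₀ * (3 * (1 + 4 * (a ^ 2 * e₂ + 1) / μ₀ ^ 2)) * K) * sp ^ 2 * E * F := by
  have he₂ : 0 ≤ e₂ := heₜ0.trans heₜ
  have hae₂ : 0 ≤ a ^ 2 * e₂ := mul_nonneg (sq_nonneg a) he₂
  set C₂ : ℝ := 3 * (1 + 4 * (a ^ 2 * e₂ + 1) / μ₀ ^ 2) with hC₂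
  have hC₂nn : 0 ≤ C₂ := by positivity
  have hcoef : (α ^ 2 * eₜ + m ^ 2) * (2 * sp ^ 2 / μ₀) ^ 2 = 4 * ((α * sp ^ 2) ^ 2 * eₜ + (m * sp ^ 2) ^ 2) / μ₀ ^ 2 := by ring
  rw [hαsp, hmsp, one_pow] at hcoef
  have haS2 : aS ^ 2 * eₜ ≤ a ^ 2 * e₂ :=
    (mul_le_mul_of_nonneg_right (pow_le_pow_left₀ haS0 haS 2) heₜ0).trans (mul_le_mul_of_nonneg_left heₜ (sq_nonneg a))
  have hcoef_le : (α ^ 2 * eₜ + m ^ 2) * (2 * sp ^ 2 / μ₀) ^ 2 ≤ 4 * (a ^ 2 * e₂ + 1) / μ₀ ^ 2 := by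
    rw [hcoef]
    exact div_le_div_of_nonneg_right (by linarith) (sq_nonneg _)
  have hG₂' : G₂ ≤ C₂ * B := by
    have h1 : α ^ 2 * A_Q ≤ α ^ 2 * (eₜ * A) := mul_le_mul_of_nonneg_left hAQ (sq_nonneg _)
    have h2 : (α ^ 2 * eₜ + m ^ 2) * A ≤ (α ^ 2 * eₜ + m ^ 2) * ((2 * sp ^ 2 / μ₀) ^ 2 * B) :=
      mul_le_mul_of_nonneg_left hA (by positivity)
    have h3 : (α ^ 2 * eₜ + m ^ 2) * (2 * sp ^ 2 / μ₀) ^ 2 * B ≤ 4 * (a ^ 2 * e₂ + 1) / μ₀ ^ 2 * B :=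
      mul_le_mul_of_nonneg_right hcoef_le hB0
    calc G₂ ≤ 3 * (B + α ^ 2 * A_Q + m ^ 2 * A) := hG₂
      _ ≤ 3 * (B + (α ^ 2 * eₜ + m ^ 2) * ((2 * sp ^ 2 / μ₀) ^ 2 * B)) := by linarith
      _ = 3 * (B + (α ^ 2 * eₜ + m ^ 2) * (2 * sp ^ 2 / μ₀) ^ 2 * B) := by ring
      _ ≤ 3 * (B + 4 * (a ^ 2 * e₂ + 1) / μ₀ ^ 2 * B) := by linarith
      _ = C₂ * B := by rw [hC₂]; ring
  have hsq : vx ^ 2 ≤ (Real.sqrt (C₀ * C₂ * K) * sp ^ 2 * E * F) ^ 2 := by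
    have h1 : W * G₂ ≤ C₀ * (sp ^ 4 / N) * (C₂ * B) := mul_le_mul hW hG₂' hG₂nn (by positivity)
    have h2 : C₀ * (sp ^ 4 / N) * (C₂ * B) ≤ C₀ * (sp ^ 4 / N) * (C₂ * (F ^ 2 * E ^ 2 * (K * N))) :=
      mul_le_mul_of_nonneg_left (mul_le_mul_of_nonneg_left hB hC₂nn) (by positivity)
    have h3 : C₀ * (sp ^ 4 / N) * (C₂ * (F ^ 2 * E ^ 2 * (K * N))) = (Real.sqrt (C₀ * C₂ * K) * sp ^ 2 * E * F) ^ 2 := by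
      rw [mul_pow, mul_pow, mul_pow, Real.sq_sqrt (by positivity)]
      field_simp
    linarith
  exact le_of_pow_le_pow_left₀ two_ne_zero (by positivity) hsq

set_option maxHeartbeats 800000 in
/-- **p. 326 / C2 p. 263: THE SUP-NORM DECAY OF THE REGION NEUMANN PROPAGATORS `G_k(Ω,u)` ON A GENERAL `k`-BLOCK UNION AT SMALL NON-FLAT
FIELDS, `k`-UNIFORM, IN OPERATOR FORM** (the VALUE member of [Balaban1983RegularityDecay] (1.10) for p31's
`G_k(Ω,u) = gBox (α_kL^{kD}) ε⁻¹ u k Ω`, `Ω` ANY union of `k`-blocks of the fine torus, `D = d + 1 ≤ 3`): there are `t₀, c₀ > 0` depending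
on `d, L, a` only such that for every volume, every `1 ≤ k ≤ m + K`, every `k`-block union `Ω`, every `U(1)` field bondwise small INSIDE `Ω`
(`|u_b − 1| ≤ T` on the in-block bonds of `Ω*`, `|u(Γ^{(k)}_{x_k,x}) − 1| ≤ δ` on `Ω`, `2(L^k−1)L^k·D·T² + 2δ² ≤ 1/2` — p34's
hypotheses),
every `x` and every source `f` with `|f| ≤ F` vanishing at `ℓ^∞`-distance `< D₀` from `x`:  `|(G_k(Ω,u)f)(x)| ≤ c₀(L^kε)²e^{−t₀D₀/L^k}F`
— p31's displayed hypothesis (H1.10) for a general region at non-flat `u`.  C2 p. 263: *"a straightforward application of the random walk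
expansion of [6] shows that |(G_{k,loc}(u)f)(x)| ≦ ce^{−c dist(suppt f,x)}‖f‖_∞ (2.30)"* — here by Kato's inequality on the region,
comparison with the free Neumann region resolvent on the torus, its tilted row (file 3b, Nash–Davies) and p34's weighted `ℓ²` (Agmon) bound.
[cite: BalabanImbrieJaffe1988, (2.30) p.263] -/
theorem decay110_smallField_region (d ℓ : ℕ) (hd3 : d + 1 ≤ 3) (hℓ : 1 ≤ ℓ) {a : ℝ} (ha : 0 < a) :
    ∃ t₀ c₀ : ℝ, 0 < t₀ ∧ 0 < c₀ ∧ ∀ (P : Params), P.d = d + 1 → P.L = ℓ + 1 →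
      ∀ k : ℕ, 1 ≤ k → k ≤ P.m + P.K → ∀ Ω : Finset (Balaban1983to89.Site P 0), IsBlockUnion k Ω →
        ∀ (U : GaugeField P 0 U1) (T δ : ℝ),
          (∀ b ∈ starB Ω, blkIter k b.src = blkIter k b.tgt → ‖toC (U b) - 1‖ ≤ T) →
          (∀ y ∈ Ω, ‖holCK U k y - 1‖ ≤ δ) →
          2 * (((P.L : ℝ) ^ k - 1) * (P.L : ℝ) ^ k) * P.d * T ^ 2 + 2 * δ ^ 2 ≤ 1 / 2 →
          ∀ (x : Balaban1983to89.Site P 0) (f : Balaban1983to89.Site P 0 → ℂ) (F D₀ : ℝ),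
            (∀ z, ‖f z‖ ≤ F) → (∀ z, f z ≠ 0 → D₀ ≤ (supDist x z : ℝ)) →
            ‖(gBox (B1RG242Torus.α P a k * (P.L : ℝ) ^ (k * P.d)) P.eps⁻¹ U k Ω *ᵥ f) x‖
              ≤ c₀ * P.spacing k ^ 2 * Real.exp (-(t₀ * D₀ / (P.L : ℝ) ^ k)) * F := by
  obtain ⟨t₁, C₀, ht₁, hC₀, hR⟩ := region_row_sq_le d ℓ hd3 hℓ
  set μ₁ : ℝ := min (1 / 4) (a / 8) with hμ₁
  have hμ₁pos : 0 < μ₁ := lt_min (by norm_num) (by positivity)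
  set t : ℝ := min (min t₁ 1) (μ₁ / ((2 * ((d + 1 : ℕ) : ℝ) + a) * Real.exp 1)) with htdef
  have htpos : 0 < t := lt_min (lt_min ht₁ one_pos) (by positivity)
  have ht₁' : t ≤ t₁ := (min_le_left _ _).trans (min_le_left _ _)
  have ht1 : t ≤ 1 := (min_le_left _ _).trans (min_le_right _ _)
  have htμ' : t ≤ μ₁ / ((2 * ((d + 1 : ℕ) : ℝ) + a) * Real.exp 1) := min_le_right _ _
  set Kt : ℝ := (2 * (1 + ((d + 1 : ℕ) : ℝ) / t)) ^ (d + 1) with hKt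
  have hKtpos : 0 < Kt := by positivity
  set C₂ : ℝ := 3 * (1 + 4 * (a ^ 2 * Real.exp 2 + 1) / μ₁ ^ 2) with hC₂
  have hC₂pos : 0 < C₂ := by positivity
  refine ⟨t / 2, Real.sqrt (C₀ * C₂ * Kt), by positivity, Real.sqrt_pos.2 (by positivity), ?_⟩
  intro P hPd hPL k hk1 hk Ω hΩ U T δ hInt hTree hsmall x f F D₀ hF hsupp
  have hk0 : 0 + k ≤ P.m + P.K := by omega
  have hLpos : (0 : ℝ) < P.L := P.cast_L_pos
  have hL1 : (1 : ℝ) < P.L := B1RG242Torus.one_lt_cast_L P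
  have hnr : 0 < (P.L : ℝ) ^ k := pow_pos hLpos k
  have hn2 : (0 : ℝ) ≤ ((P.L : ℝ) ^ k) ^ 2 := sq_nonneg _
  have hN' : 0 < ((P.L : ℝ) ^ k) ^ (d + 1) := pow_pos hnr _
  have hεpos : 0 < P.eps := P.eps_pos
  have hsp : 0 < P.spacing k := P.spacing_pos k
  have hspdef : P.spacing k = (P.L : ℝ) ^ k * P.eps := rfl
  have hF0 : 0 ≤ F := (norm_nonneg _).trans (hF x)
  have hα : 0 < B1RG242Torus.α P a k := mul_pos (B1.aSeq_pos ha hL1 hk1) (inv_pos.2 (pow_pos hsp 2))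
  have hNd : 0 < (P.L : ℝ) ^ (k * P.d) := pow_pos hLpos _
  have ha' : 0 < B1RG242Torus.α P a k * (P.L : ℝ) ^ (k * P.d) := mul_pos hα hNd
  have hc : P.eps⁻¹ ≠ 0 := inv_ne_zero hεpos.ne'
  have hm : 0 < (P.spacing k ^ 2)⁻¹ := inv_pos.2 (pow_pos hsp 2)
  have hαdef : B1RG242Torus.α P a k = B1.aSeq a P.L k * (P.spacing k ^ 2)⁻¹ := rfl
  -- the RHS is nonnegative; the trivial case `x ∉ Ω`
  have hRHS : 0 ≤ Real.sqrt (C₀ * C₂ * Kt) * P.spacing k ^ 2 * Real.exp (-(t / 2 * D₀ / (P.L : ℝ) ^ k)) * F := by positivity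
  by_cases hx : x ∈ Ω
  swap
  · rw [gBox_mulVec_eq_zero_of_not_mem hk0 hc ha' U hΩ f hx, norm_zero]; exact hRHS
  -- the objects
  set α₀ : ℝ := B1RG242Torus.α P a k with hα₀
  set m₀ : ℝ := (P.spacing k ^ 2)⁻¹ with hm₀
  set a' : ℝ := α₀ * (P.L : ℝ) ^ (k * P.d) with ha'def
  set φ : Balaban1983to89.Site P 0 → ℂ := gBox a' P.eps⁻¹ U k Ω *ᵥ f with hφ
  set v : Balaban1983to89.Site P 0 → ℝ := fun z => ‖φ z‖ with hv
  set QQ : Matrix (Balaban1983to89.Site P 0) (Balaban1983to89.Site P 0) ℝ := B1RG242Torus.Qks P k * B1RG242Torus.Qk P k with hQQ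
  set ω : Balaban1983to89.Site P 0 → ℝ := fun z => Real.exp ((-t) * (supDist x z : ℝ) / (P.L : ℝ) ^ k) with hω
  set g : Balaban1983to89.Site P 0 → ℝ := fun z => ‖f z‖ + α₀ * (QQ *ᵥ v) z + m₀ * v z with hg
  have hωpos : ∀ z, 0 < ω z := fun z => Real.exp_pos _
  have hvnn : ∀ z, 0 ≤ v z := fun z => norm_nonneg _
  have hQQnn : ∀ z, 0 ≤ (QQ *ᵥ v) z := fun z => by
    rw [hQQ, towerQQ_mulVec_apply hk]; exact mul_nonneg (by positivity) (sum_nonneg fun _ _ => hvnn _)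
  have hgnn : ∀ z, 0 ≤ g z := fun z => by
    simp only [hg]; exact add_nonneg (add_nonneg (norm_nonneg _) (mul_nonneg hα.le (hQQnn z))) (mul_nonneg hm.le (hvnn z))
  -- STEP 1: the equation on the region, `(χD_u)ᴴ(χD_u)φ = f − a′(Q_k|_Ω)ᴴ(Q_k|_Ω)φ` at the points of `Ω`
  have heq : nOp a' P.eps⁻¹ U k Ω *ᵥ φ = proj Ω *ᵥ f := nOp_mulVec_gBox_mulVec hk0 hc ha' U hΩ f
  have hDD : ∀ y ∈ Ω, (((dN P.eps⁻¹ U Ω)ᴴ * dN P.eps⁻¹ U Ω) *ᵥ φ) y = f y - (a' : ℂ) * (((qMatK U k Ω)ᴴ * qMatK U k Ω) *ᵥ φ) y := by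
    intro y hy
    have h := congr_fun heq y
    rw [nOp_eq, add_mulVec, smul_mulVec, Pi.add_apply, Pi.smul_apply, smul_eq_mul, proj_mulVec, if_pos hy] at h
    linear_combination h
  -- STEP 2: Kato on the region, `ε⁻²Σ_μ(Neumann differences of |φ|) + m₀|φ| ≤ g` at the points of `Ω`
  have hKato : ∀ y ∈ Ω, (P.eps⁻¹) ^ 2 * (∑ μ : Fin P.d,
      ((if (⟨y, μ⟩ : PBond P 0) ∈ starB Ω then v y - v (y.shift μ) else 0) +
        (if (⟨y.unshift μ, μ⟩ : PBond P 0) ∈ starB Ω then v y - v (y.unshift μ) else 0))) + m₀ * v y ≤ g y := by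
    intro y hy
    refine (kato_region P.eps⁻¹ m₀ U Ω φ y).trans ?_
    rw [hDD y hy]
    have hX := norm_gram_qMatK_region_mulVec_le hk U Ω φ y
    have h1 : ‖(a' : ℂ) * (((qMatK U k Ω)ᴴ * qMatK U k Ω) *ᵥ φ) y‖ ≤ α₀ * (QQ *ᵥ v) y := by
      rw [norm_mul, Complex.norm_real, Real.norm_of_nonneg ha'.le]
      refine (mul_le_mul_of_nonneg_left hX ha'.le).trans (le_of_eq ?_)
      rw [ha'def, mul_assoc, mul_inv_cancel_left₀ hNd.ne']
    have h2 : ‖((m₀ : ℝ) : ℂ) * φ y‖ = m₀ * v y := by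
      rw [norm_mul, Complex.norm_real, Real.norm_of_nonneg hm.le]
    calc ‖f y - (a' : ℂ) * (((qMatK U k Ω)ᴴ * qMatK U k Ω) *ᵥ φ) y + ((m₀ : ℝ) : ℂ) * φ y‖
        ≤ ‖f y - (a' : ℂ) * (((qMatK U k Ω)ᴴ * qMatK U k Ω) *ᵥ φ) y‖ + ‖((m₀ : ℝ) : ℂ) * φ y‖ := norm_add_le _ _
      _ ≤ ‖f y‖ + ‖(a' : ℂ) * (((qMatK U k Ω)ᴴ * qMatK U k Ω) *ᵥ φ) y‖ + ‖((m₀ : ℝ) : ℂ) * φ y‖ :=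
          add_le_add (norm_sub_le _ _) le_rfl
      _ ≤ g y := by rw [h2]; simp only [hg]; linarith [h1]
  -- STEP 3: ON THE TORUS, `(M|φ|)(y) ≤ (L^kε)²g(y)` for `M = L^{2k}(−Δ^N_Ω) + 1` (p34's `lapN`), at every site
  have hM : ∀ y, (((((P.L : ℝ) ^ k) ^ 2) • lapN Ω + 1) *ᵥ v) y ≤ P.spacing k ^ 2 * g y := by
    intro y
    by_cases hy : y ∈ Ω
    · have hK := hKato y hy
      rw [massOp_mulVec_apply, lapN_mulVec_apply]
      have e : ((P.L : ℝ) ^ k) ^ 2 * (∑ μ : Fin P.d,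
          ((if (⟨y, μ⟩ : PBond P 0) ∈ starB Ω then v y - v (y.shift μ) else 0) +
            (if (⟨y.unshift μ, μ⟩ : PBond P 0) ∈ starB Ω then v y - v (y.unshift μ) else 0))) + v y =
          P.spacing k ^ 2 * ((P.eps⁻¹) ^ 2 * (∑ μ : Fin P.d,
          ((if (⟨y, μ⟩ : PBond P 0) ∈ starB Ω then v y - v (y.shift μ) else 0) +
            (if (⟨y.unshift μ, μ⟩ : PBond P 0) ∈ starB Ω then v y - v (y.unshift μ) else 0))) + m₀ * v y) := by
        rw [hm₀, hspdef]; field_simp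
      rw [e]
      exact mul_le_mul_of_nonneg_left hK (pow_pos hsp 2).le
    · rw [massOp_mulVec_apply_of_not_mem _ Ω v hy]
      have hv0 : v y = 0 := by simp only [hv, hφ]; rw [gBox_mulVec_eq_zero_of_not_mem hk0 hc ha' U hΩ f hy, norm_zero]
      rw [hv0]
      exact mul_nonneg (pow_pos hsp 2).le (hgnn y)
  -- STEP 4: the comparison principle on the torus, `|φ(x)| ≤ (L^kε)²Σ_y R_Ω(x,y)g(y)`
  set R : Matrix (Balaban1983to89.Site P 0) (Balaban1983to89.Site P 0) ℝ := ((((P.L : ℝ) ^ k) ^ 2) • lapN Ω + 1)⁻¹ with hRdef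
  have hvx : v x ≤ P.spacing k ^ 2 * ∑ y, R x y * g y := by
    have h := le_inv_massOp_mulVec hn2 Ω (v := v) (g := fun y => P.spacing k ^ 2 * g y) hM x
    rw [← hRdef] at h
    refine h.trans (le_of_eq ?_)
    simp only [mulVec, dotProduct, mul_sum]
    exact sum_congr rfl fun y _ => by ring
  -- STEP 5: Cauchy–Schwarz with the weight `w = e^{t|x−·|_∞/L^k}`
  set w : Balaban1983to89.Site P 0 → ℝ := fun y => Real.exp (t * (supDist x y : ℝ) / (P.L : ℝ) ^ k) with hw
  have hwpos : ∀ y, 0 < w y := fun y => Real.exp_pos _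
  have hCS : (∑ y, R x y * g y) ^ 2 ≤ (∑ y, (w y * R x y) ^ 2) * ∑ y, ((w y)⁻¹ * g y) ^ 2 := by
    have e : ∑ y, R x y * g y = ∑ y, (w y * R x y) * ((w y)⁻¹ * g y) :=
      sum_congr rfl fun y _ => by
        rw [show w y * R x y * ((w y)⁻¹ * g y) = (w y * (w y)⁻¹) * (R x y * g y) by ring, mul_inv_cancel₀ (hwpos y).ne', one_mul]
    rw [e]
    exact sum_mul_sq_le_sq_mul_sq _ _ _
  -- the tilted row of `R_Ω` (§1)
  have hW : ∑ y, (w y * R x y) ^ 2 ≤ C₀ / ((P.L : ℝ) ^ k) ^ (d + 1) := hR P hPd hPL k hk1 hk Ω hΩ t htpos.le ht₁' x hx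
  -- the source side: `Σ_y (w(y)⁻¹g(y))² = Σ_y(ω(y)g(y))²`
  have hG2 : ∑ y, ((w y)⁻¹ * g y) ^ 2 = ∑ y, (ω y * g y) ^ 2 := by
    refine sum_congr rfl fun y _ => ?_
    have e : (w y)⁻¹ = ω y := by
      simp only [hw, hω]; rw [← Real.exp_neg]; congr 1; ring
    rw [e]
  have hv2 : v x ^ 2 ≤ (C₀ * (P.spacing k ^ 4 / ((P.L : ℝ) ^ k) ^ (d + 1))) * ∑ x', (ω x' * g x') ^ 2 := by
    have hS0 : 0 ≤ ∑ y, R x y * g y := sum_nonneg fun y _ => mul_nonneg (inv_massOp_apply_nonneg hn2 Ω x y) (hgnn y)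
    calc v x ^ 2 ≤ (P.spacing k ^ 2 * ∑ y, R x y * g y) ^ 2 := pow_le_pow_left₀ (hvnn x) hvx 2
      _ = P.spacing k ^ 4 * (∑ y, R x y * g y) ^ 2 := by ring
      _ ≤ P.spacing k ^ 4 * ((∑ y, (w y * R x y) ^ 2) * ∑ y, ((w y)⁻¹ * g y) ^ 2) := mul_le_mul_of_nonneg_left hCS (by positivity)
      _ ≤ P.spacing k ^ 4 * ((C₀ / ((P.L : ℝ) ^ k) ^ (d + 1)) * ∑ y, (ω y * g y) ^ 2) := by
          rw [hG2]
          exact mul_le_mul_of_nonneg_left (mul_le_mul_of_nonneg_right hW (sum_nonneg fun _ _ => sq_nonneg _)) (by positivity)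
      _ = (C₀ * (P.spacing k ^ 4 / ((P.L : ℝ) ^ k) ^ (d + 1))) * ∑ x', (ω x' * g x') ^ 2 := by ring
  -- STEP 6: the three pieces of `Σ_z(ω(z)g(z))²` (verbatim p27)
  set A : ℝ := ∑ z, (ω z * v z) ^ 2 with hA
  set AQ : ℝ := ∑ z, (ω z * (QQ *ᵥ v) z) ^ 2 with hAQ
  set B : ℝ := ∑ z, (ω z * ‖f z‖) ^ 2 with hB
  have hB0 : 0 ≤ B := sum_nonneg fun z _ => sq_nonneg _
  have hG₂ : ∑ z, (ω z * g z) ^ 2 ≤ 3 * (B + α₀ ^ 2 * AQ + m₀ ^ 2 * A) := by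
    have h3 : ∀ p q r : ℝ, (p + q + r) ^ 2 ≤ 3 * p ^ 2 + 3 * q ^ 2 + 3 * r ^ 2 := fun p q r => by
      nlinarith [sq_nonneg (p - q), sq_nonneg (q - r), sq_nonneg (p - r)]
    calc ∑ z, (ω z * g z) ^ 2
        ≤ ∑ z, (3 * (ω z * ‖f z‖) ^ 2 + 3 * α₀ ^ 2 * (ω z * (QQ *ᵥ v) z) ^ 2 + 3 * m₀ ^ 2 * (ω z * v z) ^ 2) :=
          sum_le_sum fun z _ => by
            have e : ω z * g z = ω z * ‖f z‖ + α₀ * (ω z * (QQ *ᵥ v) z) + m₀ * (ω z * v z) := by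
              simp only [hg]; ring
            rw [e]
            refine (h3 _ _ _).trans (le_of_eq ?_)
            ring
      _ = 3 * (B + α₀ ^ 2 * AQ + m₀ ^ 2 * A) := by
          rw [sum_add_distrib, sum_add_distrib, ← mul_sum, ← mul_sum, ← mul_sum, hB, hAQ, hA]
          ring
  -- (6a) the block piece: `A_Q ≤ e^{2t}A`
  have hoscω : ∀ z z' : Balaban1983to89.Site P 0,
      Balaban1983to89.Site.proj k k z' = Balaban1983to89.Site.proj k k z → ω z ≤ Real.exp t * ω z' := by
    intro z z' hzz
    have h1 := weight_block_osc htpos.le hk x z' z hzz.symm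
    rw [← Real.exp_add, Real.exp_le_exp] at h1
    show Real.exp _ ≤ Real.exp t * Real.exp _
    rw [← Real.exp_add, Real.exp_le_exp]
    have e1' : (-t) * (supDist x z : ℝ) / (P.L : ℝ) ^ k = -(t * (supDist x z : ℝ) / (P.L : ℝ) ^ k) := by ring
    have e2' : (-t) * (supDist x z' : ℝ) / (P.L : ℝ) ^ k = -(t * (supDist x z' : ℝ) / (P.L : ℝ) ^ k) := by ring
    rw [e1', e2']
    linarith
  have hAQle : AQ ≤ Real.exp (2 * t) * A := tilted_sq_QQ_le hk hωpos hoscω v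
  -- (6b) the source piece: `B ≤ F²e^{−tD₀/L^k}·K_tL^{kD}`
  have hBle : B ≤ F ^ 2 * Real.exp (-(t / 2 * D₀ / (P.L : ℝ) ^ k)) ^ 2 * (Kt * ((P.L : ℝ) ^ k) ^ (d + 1)) := by
    have hE : Real.exp (-(t / 2 * D₀ / (P.L : ℝ) ^ k)) ^ 2 = Real.exp (-(t * D₀ / (P.L : ℝ) ^ k)) := by
      rw [sq, ← Real.exp_add]; congr 1; ring
    rw [hE]
    have hpt : ∀ z, (ω z * ‖f z‖) ^ 2 ≤ F ^ 2 * Real.exp (-(t * D₀ / (P.L : ℝ) ^ k)) * ω z := by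
      intro z
      by_cases hz : f z = 0
      · rw [hz, norm_zero, mul_zero, sq, zero_mul]
        exact mul_nonneg (mul_nonneg (sq_nonneg _) (Real.exp_pos _).le) (hωpos z).le
      · have hDz := hsupp z hz
        have hω2 : ω z ^ 2 ≤ Real.exp (-(t * D₀ / (P.L : ℝ) ^ k)) * ω z := by
          show Real.exp _ ^ 2 ≤ Real.exp _ * Real.exp _
          rw [sq, ← Real.exp_add, ← Real.exp_add, Real.exp_le_exp]
          have : t * D₀ / (P.L : ℝ) ^ k ≤ t * (supDist x z : ℝ) / (P.L : ℝ) ^ k :=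
            div_le_div_of_nonneg_right (mul_le_mul_of_nonneg_left hDz htpos.le) hnr.le
          have e1' : (-t) * (supDist x z : ℝ) / (P.L : ℝ) ^ k = -(t * (supDist x z : ℝ) / (P.L : ℝ) ^ k) := by ring
          rw [e1']
          linarith
        have hf2 : ‖f z‖ ^ 2 ≤ F ^ 2 := pow_le_pow_left₀ (norm_nonneg _) (hF z) 2
        calc (ω z * ‖f z‖) ^ 2 = ω z ^ 2 * ‖f z‖ ^ 2 := mul_pow _ _ _
          _ ≤ (Real.exp (-(t * D₀ / (P.L : ℝ) ^ k)) * ω z) * F ^ 2 :=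
              mul_le_mul hω2 hf2 (sq_nonneg _) (mul_nonneg (Real.exp_pos _).le (hωpos z).le)
          _ = F ^ 2 * Real.exp (-(t * D₀ / (P.L : ℝ) ^ k)) * ω z := by ring
    have hsumω : ∑ z, ω z ≤ Kt * ((P.L : ℝ) ^ k) ^ (d + 1) := by
      have h := sum_exp_neg_supDist_scale_le (P := P) htpos k x
      rw [hPd] at h
      have e : ∀ z, ω z = Real.exp (-(t * (supDist x z : ℝ) / (P.L : ℝ) ^ k)) := fun z => by
        simp only [hω]; congr 1; ring
      simp_rw [e]
      exact h
    calc B = ∑ z, (ω z * ‖f z‖) ^ 2 := hB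
      _ ≤ ∑ z, F ^ 2 * Real.exp (-(t * D₀ / (P.L : ℝ) ^ k)) * ω z := sum_le_sum fun z _ => hpt z
      _ = F ^ 2 * Real.exp (-(t * D₀ / (P.L : ℝ) ^ k)) * ∑ z, ω z := by rw [mul_sum]
      _ ≤ F ^ 2 * Real.exp (-(t * D₀ / (P.L : ℝ) ^ k)) * (Kt * ((P.L : ℝ) ^ k) ^ (d + 1)) :=
          mul_le_mul_of_nonneg_left hsumω (by positivity)
  -- (6c) the Agmon piece on the region (p34): `A ≤ (2(L^kε)²/μ₁)²B`
  have hAle : A ≤ (2 * P.spacing k ^ 2 / μ₁) ^ 2 * B := by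
    have hst : |(-t)| ≤ t := by rw [abs_neg, abs_of_pos htpos]
    have hω₁ : ∀ b ∈ starB Ω, (ω b.tgt - ω b.src) ^ 2 ≤
        ((t / (P.L : ℝ) ^ k) ^ 2 * Real.exp (t / (P.L : ℝ) ^ k)) * (ω b.tgt * ω b.src) := fun b _ => weight_bond_osc_sq hst k x b
    have hω₂ : ∀ z z' : Balaban1983to89.Site P 0, blkIter k z = blkIter k z' →
        (ω z - ω z') ^ 2 ≤ (t ^ 2 * Real.exp t) * (ω z * ω z') := fun z z' hzz => weight_block_osc_sq hst hk0 x z z' hzz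
    have htμ : t ≤ min (1 / 4) (a / 8) / ((2 * P.d + a) * Real.exp 1) := by
      rw [hPd]; exact htμ'
    have hge := agmon_gap_region P ha hk1 htpos.le ht1 htμ
    have hν : 0 < μ₁ / (2 * P.spacing k ^ 2) := by positivity
    have hκ := sub_pos.1 (lt_of_lt_of_le hν hge)
    have hAg := agmon_weighted_region hk0 hΩ U hInt hTree hsmall hc ha' hωpos (by positivity) (by positivity) hω₁ hω₂ hκ f
    have hAg' : A ≤ B / (μ₁ / (2 * P.spacing k ^ 2)) ^ 2 := by
      refine hAg.trans (div_le_div_of_nonneg_left hB0 (pow_pos hν 2) ?_)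
      exact pow_le_pow_left₀ hν.le hge 2
    refine hAg'.trans (le_of_eq ?_)
    field_simp
  -- STEP 7: the scalar assembly
  have hαsp : α₀ * P.spacing k ^ 2 = B1.aSeq a P.L k := by
    rw [hαdef, hm₀, inv_mul_cancel_right₀ (pow_pos hsp 2).ne']
  have hmsp : m₀ * P.spacing k ^ 2 = 1 := by rw [hm₀]; exact inv_mul_cancel₀ (pow_pos hsp 2).ne'
  have he2t : Real.exp (2 * t) ≤ Real.exp 2 := Real.exp_le_exp.2 (by linarith)
  exact assembly_arith hv2 le_rfl hN' hC₀.le hG₂ (sum_nonneg fun z _ => sq_nonneg _) hAQle (Real.exp_pos _).le he2t hAle hB0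
    hμ₁pos hαsp (B1.aSeq_pos ha hL1 hk1).le (B1.aSeq_le ha hL1 k hk1) hmsp hBle (Real.exp_pos _).le hKtpos.le hF0

end Assembly

/-! ## §3 Corollaries: p31's displayed hypothesis (H1.10″) binder, and the bound in every gauge -/

section Corollaries

open B3Bound323ZeroTorus (T_eq_supDist)
open BIJ88DeltaLoc234Torus (mulOp gBox_gaugeAct)
open GaugeField (gaugeAct)

/-- **(H1.10) ON A GENERAL `k`-BLOCK UNION, NON-FLAT SMALL `u` — IN THE BINDER SHAPE CONSUMED BY p31's `BIJ88DeltaLocClose235General`**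
(`∀ x f F D, (∀ y, ‖f y‖ ≤ F) → (∀ y, f y ≠ 0 → D ≤ T(x,y)) → ‖(G_k(Ω,u)f)(x)‖ ≤ (L^kε)²·(c₀e^{−δ₀D/L^k}F)` with the
torus sup-distance
`T = B5Ineq137Torus.T P 0`): the theorem above with `T(x,y) = |x − y|_∞` (`B3Bound323ZeroTorus.T_eq_supDist`) and the factors reordered.
[6] (1.10) p. 573: *"|(G_k(Ω, A)f)(x)| ≤ c₀exp(−δ₀ dist(x, supp f))‖f‖_∞"*, here for `Ω` any `k`-block union of the `(L^kε)`-lattice and the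
small non-flat `u` of the hypotheses. [cite: Balaban1983RegularityDecay, (1.10) p.573] -/
theorem decay110_smallField_region_input (d ℓ : ℕ) (hd3 : d + 1 ≤ 3) (hℓ : 1 ≤ ℓ) {a : ℝ} (ha : 0 < a) :
    ∃ δ₀ c₀ : ℝ, 0 < δ₀ ∧ 0 < c₀ ∧ ∀ (P : Params), P.d = d + 1 → P.L = ℓ + 1 →
      ∀ k : ℕ, 1 ≤ k → k ≤ P.m + P.K → ∀ Ω : Finset (Balaban1983to89.Site P 0), IsBlockUnion k Ω →
        ∀ (U : GaugeField P 0 U1) (T δ : ℝ),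
          (∀ b ∈ starB Ω, blkIter k b.src = blkIter k b.tgt → ‖toC (U b) - 1‖ ≤ T) →
          (∀ y ∈ Ω, ‖holCK U k y - 1‖ ≤ δ) →
          2 * (((P.L : ℝ) ^ k - 1) * (P.L : ℝ) ^ k) * P.d * T ^ 2 + 2 * δ ^ 2 ≤ 1 / 2 →
          ∀ (x : Balaban1983to89.Site P 0) (f : Balaban1983to89.Site P 0 → ℂ) (F D : ℝ), (∀ y, ‖f y‖ ≤ F) →
            (∀ y, f y ≠ 0 → D ≤ B5Ineq137Torus.T P 0 x y) →
            ‖(gBox (B1RG242Torus.α P a k * (P.L : ℝ) ^ (k * P.d)) P.eps⁻¹ U k Ω *ᵥ f) x‖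
              ≤ P.spacing k ^ 2 * (c₀ * Real.exp (-(δ₀ * (((P.L : ℝ) ^ k)⁻¹ * D))) * F) := by
  obtain ⟨t₀, c₀, ht₀, hc₀, h⟩ := decay110_smallField_region d ℓ hd3 hℓ ha
  refine ⟨t₀, c₀, ht₀, hc₀, ?_⟩
  intro P hPd hPL k hk1 hk Ω hΩ U T δ hInt hTree hsmall x f F D hF hsupp
  have hsupp' : ∀ z, f z ≠ 0 → D ≤ (supDist x z : ℝ) := fun z hz => by rw [← T_eq_supDist]; exact hsupp z hz
  have hmain := h P hPd hPL k hk1 hk Ω hΩ U T δ hInt hTree hsmall x f F D hF hsupp'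
  have e : t₀ * D / (P.L : ℝ) ^ k = t₀ * (((P.L : ℝ) ^ k)⁻¹ * D) := by rw [div_eq_mul_inv]; ring
  rw [e] at hmain
  calc _ ≤ _ := hmain
    _ = _ := by ring

/-- **THE BOUND IN EVERY GAUGE**: `G_k(Ω,u^h) = M_hG_k(Ω,u)M_hᴴ` (p31 `BIJ88DeltaLoc234Torus.gBox_gaugeAct`, [I] (6.3.2)) and `M_hᴴf` has
the modulus and the support of `f`, so `G_k(Ω,u^h)` obeys the bound of `decay110_smallField_region_input` for EVERY gauge transformation
`h` — the small-field conditions need only hold for a gauge-equivalent field ([I] p. 326: *"under the restriction (7.3.1) on the gauge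
field"*, a restriction on the orbit). [cite: BalabanImbrieJaffe1985, (6.3.2) p.320] -/
theorem decay110_smallField_region_gaugeAct (d ℓ : ℕ) (hd3 : d + 1 ≤ 3) (hℓ : 1 ≤ ℓ) {a : ℝ} (ha : 0 < a) :
    ∃ δ₀ c₀ : ℝ, 0 < δ₀ ∧ 0 < c₀ ∧ ∀ (P : Params), P.d = d + 1 → P.L = ℓ + 1 →
      ∀ k : ℕ, 1 ≤ k → k ≤ P.m + P.K → ∀ Ω : Finset (Balaban1983to89.Site P 0), IsBlockUnion k Ω →
        ∀ (U : GaugeField P 0 U1) (T δ : ℝ),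
          (∀ b ∈ starB Ω, blkIter k b.src = blkIter k b.tgt → ‖toC (U b) - 1‖ ≤ T) →
          (∀ y ∈ Ω, ‖holCK U k y - 1‖ ≤ δ) →
          2 * (((P.L : ℝ) ^ k - 1) * (P.L : ℝ) ^ k) * P.d * T ^ 2 + 2 * δ ^ 2 ≤ 1 / 2 →
          ∀ (h : GaugeTransf P 0 U1) (x : Balaban1983to89.Site P 0) (f : Balaban1983to89.Site P 0 → ℂ) (F D : ℝ),
            (∀ y, ‖f y‖ ≤ F) → (∀ y, f y ≠ 0 → D ≤ B5Ineq137Torus.T P 0 x y) →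
            ‖(gBox (B1RG242Torus.α P a k * (P.L : ℝ) ^ (k * P.d)) P.eps⁻¹ (gaugeAct h U) k Ω *ᵥ f) x‖
              ≤ P.spacing k ^ 2 * (c₀ * Real.exp (-(δ₀ * (((P.L : ℝ) ^ k)⁻¹ * D))) * F) := by
  obtain ⟨t₀, c₀, ht₀, hc₀, hmain⟩ := decay110_smallField_region_input d ℓ hd3 hℓ ha
  refine ⟨t₀, c₀, ht₀, hc₀, ?_⟩
  intro P hPd hPL k hk1 hk Ω hΩ U T δ hInt hTree hsmall h x f F D hF hsupp
  have hk0 : 0 + k ≤ P.m + P.K := by omega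
  have hL1 : (1 : ℝ) < P.L := B1RG242Torus.one_lt_cast_L P
  have ha' : 0 < B1RG242Torus.α P a k * (P.L : ℝ) ^ (k * P.d) :=
    mul_pos (mul_pos (B1.aSeq_pos ha hL1 hk1) (inv_pos.2 (pow_pos (P.spacing_pos k) 2))) (pow_pos P.cast_L_pos _)
  have hc' : P.eps⁻¹ ≠ 0 := inv_ne_zero P.eps_pos.ne'
  have hmo : ∀ (w : Balaban1983to89.Site P 0 → ℂ) (z : Balaban1983to89.Site P 0), (mulOp h *ᵥ w) z = toC (h z) * w z :=
    fun w z => by simp only [mulOp, mulVec_diagonal]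
  have hg : ∀ z : Balaban1983to89.Site P 0, ((mulOp h)ᴴ *ᵥ f) z = star (toC (h z)) * f z := fun z => by
    simp only [mulOp, diagonal_conjTranspose, mulVec_diagonal, Pi.star_apply]
  rw [gBox_gaugeAct hk0 hc' ha' h U hΩ, ← mulVec_mulVec, ← mulVec_mulVec, hmo, norm_mul, norm_toC, one_mul]
  refine hmain P hPd hPL k hk1 hk Ω hΩ U T δ hInt hTree hsmall x _ F D (fun y => ?_) (fun y hy => hsupp y ?_)
  · rw [hg, norm_mul, norm_star, norm_toC, one_mul]; exact hF y
  · intro hf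
    exact hy (by rw [hg, hf, mul_zero])

end Corollaries

/-! ## §4 (v1.1) The bound under (7.3.1)-TYPE plaquette smallness with a threshold depending on `(d, L^k)` only, for EVERY block union:
the blockwise centred gauge (p34 gen 17 `smallField_blockGauge`) -/

section Uniform

open BIJ88DeltaLoc234Torus (mulOp gBox_gaugeAct conjTranspose_mul_mulOp)
open GaugeField (gaugeAct plaqHol)
open BIJ85CentredAxialGauge (centredGauge)
open BIJ88NeumannPropagatorSmallPlaquetteRegion (smallField_blockGauge)

/-- **THE `k`-UNIFORM OPERATOR-FORM BOUND ON A GENERAL `k`-BLOCK UNION UNDER (7.3.1)-TYPE PLAQUETTE SMALLNESS OF THE FINE FIELD, WITH A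
THRESHOLD DEPENDING ON `(d, L^k)` ONLY** — uniform in the region, the volume and the field (the region analogue of p27's
`decay110_smallPlaquette_cube_uniform`): there are `δ₀, c₀ > 0` depending on `(d, ℓ, a)` only such that for every volume with
`P.d = d + 1 ≤ 3`, `P.L = ℓ + 1` and more than two `k`-blocks per direction (`2(L^k − 1) + 4 < |T|`), every `1 ≤ k ≤ m + K`, every `U(1)`
field with `|u(∂p) − 1| ≤ θ` for all plaquettes of the fine torus, every `T ≥ d(L^k − 1)θ` (`d = P.d − 1`) with
`2(L^k−1)L^k(d+1)T² + 2((d+1)(L^k−1)T)² ≤ 1/2`, EVERY `k`-block union `Ω`, every `x` and every `f` with `‖f‖_∞ ≤ F` vanishing on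
`{T(x,·) < D}`: `‖(G_k(Ω,u)f)(x)‖ ≤ (L^kε)²·c₀e^{−δ₀D/L^k}F`.  PROOF: §2's hypotheses are BLOCK-LOCAL, so the change of gauge of [I] p. 326
(*"by change of gauge u_k can be transformed in a local region Λ into a configuration … smooth and small"*) is made block by block — p34's
`smallField_blockGauge` (p30's centred axial gauge of each `k`-block) delivers §3's hypotheses for `u^h` on the whole torus, and
`G_k(Ω,u) = M_hᴴG_k(Ω,u^h)M_h` (p31 `gBox_gaugeAct`).  HONEST SCOPE: the hypothesis is the smallness `|u(∂p) − 1| ≤ θ` of the FINE-torus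
plaquettes of `u` with a threshold `θ ≲ 1/((d+1)²L^{2k})`; the PRINTED (7.3.1) is a smallness of the UNIT-lattice plaquette variables
`|v(∂p) − 1| ≦ e_kμ(e_k)` — nothing beyond the displayed inequalities is asserted about the passage between them (p33's
`BIJ85Claim73PropagatorDecay` lane; p27's HONEST SCOPE (iv)). [cite: BalabanImbrieJaffe1985, (7.3.1)–(7.3.2) p.326] -/
theorem decay110_smallPlaquette_region_uniform (d ℓ : ℕ) (hd3 : d + 1 ≤ 3) (hℓ : 1 ≤ ℓ) {a : ℝ} (ha : 0 < a) :
    ∃ δ₀ c₀ : ℝ, 0 < δ₀ ∧ 0 < c₀ ∧ ∀ (P : Params), P.d = d + 1 → P.L = ℓ + 1 →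
      ∀ k : ℕ, 1 ≤ k → k ≤ P.m + P.K → 2 * (P.L ^ k - 1) + 4 < P.sitesPerDir 0 →
      ∀ (U : GaugeField P 0 U1) (θ : ℝ), 0 ≤ θ → (∀ p : Balaban1983to89.Plaq P 0, ‖toC (plaqHol U p) - 1‖ ≤ θ) →
        ∀ (T : ℝ), ((P.d - 1 : ℕ) : ℝ) * ((P.L : ℝ) ^ k - 1) * θ ≤ T →
          2 * (((P.L : ℝ) ^ k - 1) * (P.L : ℝ) ^ k) * P.d * T ^ 2 + 2 * (P.d * ((P.L : ℝ) ^ k - 1) * T) ^ 2 ≤ 1 / 2 →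
        ∀ Ω : Finset (Balaban1983to89.Site P 0), IsBlockUnion k Ω →
          ∀ (x : Balaban1983to89.Site P 0) (f : Balaban1983to89.Site P 0 → ℂ) (F D : ℝ), (∀ y, ‖f y‖ ≤ F) →
            (∀ y, f y ≠ 0 → D ≤ B5Ineq137Torus.T P 0 x y) →
            ‖(gBox (B1RG242Torus.α P a k * (P.L : ℝ) ^ (k * P.d)) P.eps⁻¹ U k Ω *ᵥ f) x‖
              ≤ P.spacing k ^ 2 * (c₀ * Real.exp (-(δ₀ * (((P.L : ℝ) ^ k)⁻¹ * D))) * F) := by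
  obtain ⟨δ₀, c₀, hδ₀, hc₀, H⟩ := decay110_smallField_region_input d ℓ hd3 hℓ ha
  refine ⟨δ₀, c₀, hδ₀, hc₀, ?_⟩
  intro P hPd hPL k hk1 hk hR U θ hθ hplaq T hT hsmall Ω hΩ x f F D hF hsupp
  have hk0 : 0 + k ≤ P.m + P.K := by omega
  have hL1 : (1 : ℝ) < P.L := B1RG242Torus.one_lt_cast_L P
  have ha' : 0 < B1RG242Torus.α P a k * (P.L : ℝ) ^ (k * P.d) :=
    mul_pos (mul_pos (B1.aSeq_pos ha hL1 hk1) (inv_pos.2 (pow_pos (P.spacing_pos k) 2))) (pow_pos P.cast_L_pos _)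
  have hc' : P.eps⁻¹ ≠ 0 := inv_ne_zero P.eps_pos.ne'
  obtain ⟨hbond, htree⟩ := smallField_blockGauge hk0 U hθ hplaq hR hT
  set h : GaugeTransf P 0 U1 := fun z => centredGauge U (cornerIter k (blkIter k z)) (P.L ^ k - 1) z with hh
  -- `G_k(Ω,u) = M_hᴴ·G_k(Ω,u^h)·M_h`
  have hGU : gBox (B1RG242Torus.α P a k * (P.L : ℝ) ^ (k * P.d)) P.eps⁻¹ U k Ω =
      (mulOp h)ᴴ * gBox (B1RG242Torus.α P a k * (P.L : ℝ) ^ (k * P.d)) P.eps⁻¹ (gaugeAct h U) k Ω * mulOp h := by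
    rw [gBox_gaugeAct hk0 hc' ha' h U hΩ, Matrix.mul_assoc, Matrix.mul_assoc, Matrix.mul_assoc, conjTranspose_mul_mulOp,
      Matrix.mul_one, ← Matrix.mul_assoc, conjTranspose_mul_mulOp, Matrix.one_mul]
  have hmo : ∀ (w : Balaban1983to89.Site P 0 → ℂ) (z : Balaban1983to89.Site P 0), (mulOp h *ᵥ w) z = toC (h z) * w z :=
    fun w z => by simp only [mulOp, mulVec_diagonal]
  have hmoH : ∀ (w : Balaban1983to89.Site P 0 → ℂ) (z : Balaban1983to89.Site P 0), ((mulOp h)ᴴ *ᵥ w) z = star (toC (h z)) * w z :=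
    fun w z => by simp only [mulOp, diagonal_conjTranspose, mulVec_diagonal, Pi.star_apply]
  rw [hGU, ← mulVec_mulVec, ← mulVec_mulVec, hmoH, norm_mul, norm_star, norm_toC, one_mul]
  refine H P hPd hPL k hk1 hk Ω hΩ (gaugeAct h U) T (P.d * ((P.L : ℝ) ^ k - 1) * T) (fun b _ hb => hbond b hb)
    (fun z _ => htree z) hsmall x _ F D (fun y => ?_) (fun y hy => hsupp y ?_)
  · rw [hmo, norm_mul, norm_toC, one_mul]; exact hF y
  · intro hf
    exact hy (by rw [hmo, hf, mul_zero])

end Uniform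

end

end Literature.MathematicalPhysics.QuantumFieldTheory.BalabanImbrieJaffe1984to88.BIJ88NeumannPropagatorSmallFieldRegionSup
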